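import Summits.ValiantsHypothesis.ValiantsHypothesis.Theses.SymPencil

/-! Calibration of the split of `SdcThesis` (crux-strategist cstrat-5673): the piece
`EquivariantSdcNotQP` (stmt-17792) is a CONSEQUENCE of `SdcThesis` (stmt-5673) — an equivariant
symmetric pencil is a symmetric pencil — hence strictly on the weak side of the crux; it is load-bearing
because the glue `SdcThesisOfSubs` uses it toward `SdcThesis`. The converse needs `SymmetrizePermPairs`. -/

namespace Summit.ValiantsHypothesis.ValiantsHypothesis.Cruxes.SdcThesis.Calibration

open Summit.ValiantsHypothesis.ValiantsHypothesis.Theses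

theorem equivariantSdcNotQP_of_sdcThesis (hX : SymPencil.SdcThesis) : SymPencil.EquivariantSdcNotQP := by
  rintro ⟨c, hc⟩
  apply hX
  refine ⟨c, fun n => ?_⟩
  obtain ⟨m, hm, A, hAs, hA⟩ := hc n
  exact ⟨m, hm, A, hAs, hA.isAffineDetRepr⟩

end Summit.ValiantsHypothesis.ValiantsHypothesis.Cruxes.SdcThesis.Calibration
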